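import Literature.Analysis.FluidPDE.TaoQuantitativeLocalBlock
import Mathlib.Analysis.Convolution
import HarnessLib

/-!
# Tao 2021, §2: algebra of convolution kernels — associativity on bounded data, tails of `k ⋆ h`

Analysis/FluidPDE proof file (theorems only, no named facts), step 8f-2 of the inline programme
for `Literature.Analysis.FluidPDE.tao_quantitative_ess` (Tao 2021, Thm. 1.2).

T. Tao, arXiv:1908.04958v2, §2 pp. 7–8: the multipliers `P_N`, `e^{tΔ}`, `∇`, `ℙ` "commute with
other Fourier multipliers", they are convolution operators `T_m f = f ∗ K`, and (2.2) is proved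
by splitting the kernel into `K 1_{B(0,A)}` and `K 1_{B(0,A)ᶜ}`. In the kernel language of this
programme the composite operators of Prop. 3.1 (iv) (e.g. `P_N e^{(t−t')Δ}ℙ∇·`, realised as
`Δ̇_j e^{(σ/2)Δ} T_{σ/2}`) have kernels that are convolutions `k ⋆ h` of two integrable
kernels, and one needs (a) that the composite operator is the convolution with the composite
kernel and (b) the tails of `k ⋆ h`. This file proves, for real kernels `k, h` on a
finite-dimensional inner product space:

* `convolution_assoc_of_bounded` — `k ⋆ (h ⋆ F) = (k ⋆ h) ⋆ F` pointwise, for integrable `k, h`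
  and bounded a.e.-strongly measurable vector data `F` (Fubini);
* `lintegral_far_convolution_le` — **tails of a composite kernel**:
  `∫_{‖x‖≥ρ} |k ⋆ h| ≤ ‖k‖₁ ∫_{‖s‖≥ρ/2} |h| + (∫_{‖t‖≥ρ/2} |k|) ‖h‖₁`.

## References

* T. Tao, arXiv:1908.04958v2 (2021), §2, Lemma 2.1 proof p. 8. [Tao2021QuantitativeNS]
-/

noncomputable section

open MeasureTheory Set Function Filter Topology Metric
open scoped ENNReal NNReal Convolution

namespace Literature.Analysis.FluidPDE

variable {E : Type*} [NormedAddCommGroup E] [InnerProductSpace ℝ E] [FiniteDimensional ℝ E]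
  [MeasurableSpace E] [BorelSpace E]
variable {F : Type*} [NormedAddCommGroup F] [NormedSpace ℝ F] [CompleteSpace F]

/-! ## Associativity on bounded data -/

omit [CompleteSpace F] in
/-- The double convolution integrand `(y, t) ↦ (k(t) h(y − t)) • G(x − y)` is integrable for
integrable `k, h` and bounded `G`. [folklore] -/
theorem integrable_convolution_integrand_smul {k h : E → ℝ} (hk : Integrable k volume)
    (hh : Integrable h volume) {G : E → F} (hG : AEStronglyMeasurable G volume) {M : ℝ}
    (hM : ∀ y, ‖G y‖ ≤ M) (x : E) :
    Integrable (fun p : E × E => (k p.2 * h (p.1 - p.2)) • G (x - p.1))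
      ((volume : Measure E).prod volume) := by
  have hI := hk.convolution_integrand (ContinuousLinearMap.mul ℝ ℝ) hh (μ := volume) (ν := volume)
  have hI' : Integrable (fun p : E × E => k p.2 * h (p.1 - p.2)) ((volume : Measure E).prod volume) := by
    simpa only [ContinuousLinearMap.mul_apply'] using hI
  have hGm : AEStronglyMeasurable (fun p : E × E => G (x - p.1)) ((volume : Measure E).prod volume) :=
    (hG.comp_quasiMeasurePreserving
      (Measure.measurePreserving_sub_left volume x).quasiMeasurePreserving).comp_fst
  refine (hI'.norm.mul_const M).mono' (hI'.1.smul hGm) (Eventually.of_forall fun p => ?_)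
  rw [norm_smul]
  exact mul_le_mul_of_nonneg_left (hM _) (norm_nonneg _)

/-- **Associativity of convolution on bounded data**: for real integrable kernels `k, h` and a
bounded a.e.-strongly measurable `G`, `(k ⋆ (h ⋆ G))(x) = ((k ⋆ h) ⋆ G)(x)` for every `x`
(Fubini). [folklore] -/
theorem convolution_assoc_of_bounded {k h : E → ℝ} (hk : Integrable k volume)
    (hh : Integrable h volume) {G : E → F} (hG : AEStronglyMeasurable G volume) {M : ℝ}
    (hM : ∀ y, ‖G y‖ ≤ M) (x : E) :
    (k ⋆[ContinuousLinearMap.lsmul ℝ ℝ, volume] (h ⋆[ContinuousLinearMap.lsmul ℝ ℝ, volume] G)) x =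
      ((k ⋆[ContinuousLinearMap.lsmul ℝ ℝ, volume] h) ⋆[ContinuousLinearMap.lsmul ℝ ℝ, volume] G) x := by
  simp only [convolution_lsmul]
  -- inner substitution `s = y - t` on the left
  have hinner : ∀ t, ∫ s, h s • G (x - t - s) = ∫ y, h (y - t) • G (x - y) := fun t => by
    rw [← integral_sub_right_eq_self (fun s => h s • G (x - t - s)) t]
    refine integral_congr_ae (Eventually.of_forall fun y => ?_)
    simp only [sub_sub_sub_cancel_right]
  simp_rw [hinner]
  -- Fubini
  have hF := integrable_convolution_integrand_smul hk hh hG hM x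
  calc ∫ t, k t • ∫ y, h (y - t) • G (x - y)
      = ∫ t, ∫ y, (k t * h (y - t)) • G (x - y) := by
        refine integral_congr_ae (Eventually.of_forall fun t => ?_)
        dsimp only
        rw [← integral_smul]
        refine integral_congr_ae (Eventually.of_forall fun y => ?_)
        dsimp only
        rw [smul_smul]
    _ = ∫ y, ∫ t, (k t * h (y - t)) • G (x - y) := integral_integral_swap hF.swap
    _ = ∫ y, (∫ t, k t * h (y - t)) • G (x - y) := by
        refine integral_congr_ae (Eventually.of_forall fun y => ?_)
        dsimp only
        rw [integral_smul_const]
    _ = ∫ y, (∫ t, k t • h (y - t)) • G (x - y) := rfl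

/-! ## Tails of a composite kernel -/

/-- Tonelli for `(x, t) ↦ a(t) b(x − t)`: `∫∫ a(t) b(x − t) dt dx = (∫ a)(∫ b)` in `ℝ≥0∞`. [folklore] -/
theorem lintegral_lintegral_mul_sub_eq {a b : E → ℝ≥0∞} (ha : AEMeasurable a volume)
    (hb : AEMeasurable b volume) :
    ∫⁻ x, ∫⁻ t, a t * b (x - t) = (∫⁻ t, a t) * ∫⁻ s, b s := by
  have hj : AEMeasurable (uncurry fun x t => a t * b (x - t)) ((volume : Measure E).prod volume) :=
    (ha.comp_snd).mul (hb.comp_quasiMeasurePreserving (quasiMeasurePreserving_sub volume volume))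
  rw [lintegral_lintegral_swap hj]
  calc ∫⁻ t, ∫⁻ x, a t * b (x - t)
      = ∫⁻ t, a t * ∫⁻ s, b s := by
        refine lintegral_congr fun t => ?_
        have hbt : AEMeasurable (fun x => b (x - t)) volume := hb.comp_quasiMeasurePreserving
          (measurePreserving_sub_right volume t).quasiMeasurePreserving
        rw [lintegral_const_mul'' _ hbt, lintegral_sub_right_eq_self (fun s => b s) t]
    _ = _ := by rw [lintegral_mul_const'' _ ha]

/-- **Tails of `k ⋆ h`**: for real a.e.-strongly measurable kernels and any `ρ`,
`∫_{‖x‖≥ρ} |k ⋆ h| ≤ ‖k‖₁ ∫_{‖s‖≥ρ/2} |h| + (∫_{‖t‖≥ρ/2} |k|) ‖h‖₁` — if `‖x‖ ≥ ρ` then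
`‖t‖ ≥ ρ/2` or `‖x − t‖ ≥ ρ/2`. [cite: Tao2021QuantitativeNS, Lemma 2.1 proof p. 8] -/
theorem lintegral_far_convolution_le {k h : E → ℝ} (hk : AEStronglyMeasurable k volume)
    (hh : AEStronglyMeasurable h volume) (ρ : ℝ) :
    ∫⁻ x, ‖(ball (0 : E) ρ)ᶜ.indicator (k ⋆[ContinuousLinearMap.lsmul ℝ ℝ, volume] h) x‖ₑ ≤
      (∫⁻ t, ‖k t‖ₑ) * (∫⁻ s, ‖(ball (0 : E) (ρ / 2))ᶜ.indicator h s‖ₑ) +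
        (∫⁻ t, ‖(ball (0 : E) (ρ / 2))ᶜ.indicator k t‖ₑ) * ∫⁻ s, ‖h s‖ₑ := by
  have hkm : AEMeasurable (fun t => ‖k t‖ₑ) volume := hk.enorm
  have hkfm : AEMeasurable (fun t => ‖(ball (0 : E) (ρ / 2))ᶜ.indicator k t‖ₑ) volume :=
    (hk.indicator measurableSet_ball.compl).enorm
  have hhm : AEMeasurable (fun s => ‖h s‖ₑ) volume := hh.enorm
  have hhfm : AEMeasurable (fun s => ‖(ball (0 : E) (ρ / 2))ᶜ.indicator h s‖ₑ) volume :=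
    (hh.indicator measurableSet_ball.compl).enorm
  -- pointwise: `1_far(x) |k ⋆ h (x)| ≤ ∫ (|k t| |h_far (x-t)| + |k_far t| |h (x-t)|) dt`
  have hpt : ∀ x, ‖(ball (0 : E) ρ)ᶜ.indicator (k ⋆[ContinuousLinearMap.lsmul ℝ ℝ, volume] h) x‖ₑ ≤
      (∫⁻ t, ‖k t‖ₑ * ‖(ball (0 : E) (ρ / 2))ᶜ.indicator h (x - t)‖ₑ) +
        ∫⁻ t, ‖(ball (0 : E) (ρ / 2))ᶜ.indicator k t‖ₑ * ‖h (x - t)‖ₑ := by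
    intro x
    by_cases hx : x ∈ (ball (0 : E) ρ)ᶜ
    · have hAt : AEMeasurable (fun t => ‖k t‖ₑ * ‖(ball (0 : E) (ρ / 2))ᶜ.indicator h (x - t)‖ₑ) volume :=
        hkm.mul (hhfm.comp_quasiMeasurePreserving
          (Measure.measurePreserving_sub_left volume x).quasiMeasurePreserving)
      rw [indicator_of_mem hx, convolution_lsmul, ← lintegral_add_left' hAt]
      refine (enorm_integral_le_lintegral_enorm _).trans (lintegral_mono fun t => ?_)
      rw [enorm_smul]
      rw [mem_compl_iff, mem_ball_zero_iff, not_lt] at hx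
      by_cases ht : t ∈ (ball (0 : E) (ρ / 2))ᶜ
      · rw [indicator_of_mem ht]
        exact le_add_left le_rfl
      · have hxt : x - t ∈ (ball (0 : E) (ρ / 2))ᶜ := by
          rw [mem_compl_iff, mem_ball_zero_iff, not_lt] at ht ⊢
          push Not at ht
          have h1 : ‖x‖ ≤ ‖x - t‖ + ‖t‖ := norm_le_norm_sub_add x t
          linarith
        rw [indicator_of_mem hxt]
        exact le_add_right le_rfl
    · rw [indicator_of_notMem hx, enorm_zero]; exact bot_le
  -- integrate
  have hA : AEMeasurable (fun x => ∫⁻ t, ‖k t‖ₑ * ‖(ball (0 : E) (ρ / 2))ᶜ.indicator h (x - t)‖ₑ) volume :=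
    ((hkm.comp_snd).mul (hhfm.comp_quasiMeasurePreserving
      (quasiMeasurePreserving_sub volume volume))).lintegral_prod_right'
  calc ∫⁻ x, ‖(ball (0 : E) ρ)ᶜ.indicator (k ⋆[ContinuousLinearMap.lsmul ℝ ℝ, volume] h) x‖ₑ
      ≤ ∫⁻ x, ((∫⁻ t, ‖k t‖ₑ * ‖(ball (0 : E) (ρ / 2))ᶜ.indicator h (x - t)‖ₑ) +
          ∫⁻ t, ‖(ball (0 : E) (ρ / 2))ᶜ.indicator k t‖ₑ * ‖h (x - t)‖ₑ) := lintegral_mono hpt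
    _ = (∫⁻ x, ∫⁻ t, ‖k t‖ₑ * ‖(ball (0 : E) (ρ / 2))ᶜ.indicator h (x - t)‖ₑ) +
          ∫⁻ x, ∫⁻ t, ‖(ball (0 : E) (ρ / 2))ᶜ.indicator k t‖ₑ * ‖h (x - t)‖ₑ := lintegral_add_left' hA _
    _ = _ := by rw [lintegral_lintegral_mul_sub_eq hkm hhfm, lintegral_lintegral_mul_sub_eq hkfm hhm]

end Literature.Analysis.FluidPDE
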